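import Summits.QuantumFields.YangMills.Theorems.LuscherReductionTwistedTraceScalingToronLinkSpectrum
import Summits.QuantumFields.YangMills.Theorems.LuscherReductionTwistedTraceScalingCovariantHessianInvariance
import HarnessLib

/-!
# The spectral bridge on the whole GAUGE ORBIT of a constant abelian background: every orthonormal eigenframe of `‖D_{g·V_θ}·‖²` has
# `Σ_modes modeZPE(κ·aᵢ) = 2·toronZPE L κ 0 0 + 4·toronZPE L κ 0 (2θ)`
# (VALLEY term of S-BASE, crux `TwistedTraceScaling` stmt-QuantumFields-20203; design `pub/ym-fleet/ym-luscher-20007-p1/COARSE-DESIGN.md` §12–§13)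

A valley configuration is close to a flat connection, i.e. to some `V_θ` only UP TO GAUGE.  Lane B's covariance of the covariant curl
(`…CovariantHessianInvariance.covCurl_gaugeTransform_eq`: `D_{U^g}(R_g w) = R'_g(D_U w)` with the base-point rotations `R_g = rotLink g`, `R'_g = rotPlaq g`)
transports diagonalising frames along gauge orbits (`Frame.IsDiag.rotate`), and frame independence (`…ToronFrames`) then moves the zero-point sum of
`…ToronLinkSpectrum` to every frame at every point of the orbit (★★★ `sum_modeZPE_of_isDiag_covCurl_gaugeTransform_abelianCfg`).
Also: `inner_rotLink`, `inner_rotPlaq` (the rotations are isometries in inner-product form), `rotFrame`; and the two symmetry groups FIXING `V_θ` — global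
`T₃`-rotations (`gaugeTransform_const_diagSU2_abelianCfg`, `Frame.IsDiag.rotateT3`) and lattice translations (`shiftCfg`/`shiftLink`/`shiftPlaq`,
★ `covCurl_shiftCfg`, `Frame.IsDiag.translate(_abelianCfg)`) — act on the diagonalising frames of `‖D_{V_θ}·‖²` itself: the symmetry input of the
valley's second-order perturbation theory (design §13 (γ2)).

HONEST FRAMING: fixed-lattice linear algebra; femto rung R2b1 (brick for a stub of a child of a CONDITIONAL route); not a gap, not Clay.
-/

set_option autoImplicit false

noncomputable section

open Finset Module
open scoped BigOperators InnerProductSpace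
open Literature.MathematicalPhysics.QuantumFieldTheory
open Literature.MathematicalPhysics.QuantumLattice

namespace Summit.QuantumFields.YangMills.Theorems.FemtoTransferGap.TwoLattice.Toron

open Summit.QuantumFields.YangMills.Theorems.FemtoTransferGap
open Summit.QuantumFields.YangMills.Theorems.FemtoTransferGap.TwoLattice
open Summit.QuantumFields.YangMills.Theorems.FemtoTransferGap.TwoLattice.Cov
open Summit.QuantumFields.YangMills.Theorems.FemtoTransferGap.TwoLattice.Stiff

variable (L : ℕ) [NeZero L]

/-! ## §1 The base-point rotations preserve inner products -/

/-- Polarised orthogonality of `Ad`: `Σ_a (Ad(A)v)_a (Ad(A)w)_a = Σ_a v_a w_a`. [cite: BrockerTomDieck1985, I (1.10)] -/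
theorem sum_adRot_mulVec_mul (A : SU2) (v w : Fin 3 → ℝ) :
    ∑ a, (adRot A).mulVec v a * (adRot A).mulVec w a = ∑ a, v a * w a := by
  have e1 : ∀ f g : Fin 3 → ℝ, 4 * ∑ a, f a * g a = ∑ a, (f + g) a ^ 2 - ∑ a, (f - g) a ^ 2 := fun f g => by
    simp only [Fin.sum_univ_three, Pi.add_apply, Pi.sub_apply]; ring
  have h1 := e1 ((adRot A).mulVec v) ((adRot A).mulVec w)
  rw [← Matrix.mulVec_add, ← Matrix.mulVec_sub, sum_sq_adRot_mulVec, sum_sq_adRot_mulVec] at h1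
  have h2 := e1 v w
  linarith

/-- `R_g` preserves the inner product of `LinkSpace L`. [folklore] -/
theorem inner_rotLink (g : Site 3 L → SU2) (v w : LinkSpace L) : ⟪rotLink g v, rotLink g w⟫_ℝ = ⟪v, w⟫_ℝ := by
  rw [PiLp.inner_apply, PiLp.inner_apply, Fintype.sum_prod_type (f := fun x : Edge 3 L × Fin 3 => ⟪rotLink g v x, rotLink g w x⟫_ℝ),
    Fintype.sum_prod_type (f := fun x : Edge 3 L × Fin 3 => ⟪v x, w x⟫_ℝ)]
  refine sum_congr rfl fun e _ => ?_
  simp only [rotLink_apply, RCLike.inner_apply, conj_trivial]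
  exact sum_adRot_mulVec_mul (g e.1) (fun b => w (e, b)) (fun b => v (e, b))

/-- `R'_g` preserves the inner product of `PlaqSpace L`. [folklore] -/
theorem inner_rotPlaq (g : Site 3 L → SU2) (F G : PlaqSpace L) : ⟪rotPlaq g F, rotPlaq g G⟫_ℝ = ⟪F, G⟫_ℝ := by
  rw [PiLp.inner_apply, PiLp.inner_apply, Fintype.sum_prod_type (f := fun x : Plaquette 3 L × Fin 3 => ⟪rotPlaq g F x, rotPlaq g G x⟫_ℝ),
    Fintype.sum_prod_type (f := fun x : Plaquette 3 L × Fin 3 => ⟪F x, G x⟫_ℝ)]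
  refine sum_congr rfl fun p _ => ?_
  simp only [rotPlaq_apply, RCLike.inner_apply, conj_trivial]
  exact sum_adRot_mulVec_mul (g p.1) (fun b => G (p, b)) (fun b => F (p, b))

/-! ## §2 Rotating a diagonalising frame along the gauge orbit -/

/-- A rotated orthonormal frame is orthonormal. [folklore] -/
theorem orthonormal_rotLink {ι : Type*} [Fintype ι] (g : Site 3 L → SU2) (e : OrthonormalBasis ι ℝ (LinkSpace L)) :
    Orthonormal ℝ (fun i => rotLink g (e i)) := by
  classical
  rw [orthonormal_iff_ite]
  intro i j
  rw [inner_rotLink, orthonormal_iff_ite.mp e.orthonormal i j]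

/-- The rotated frame `R_g e` as an orthonormal basis. [folklore] -/
def rotFrame {ι : Type*} [Fintype ι] (g : Site 3 L → SU2) (e : OrthonormalBasis ι ℝ (LinkSpace L)) : OrthonormalBasis ι ℝ (LinkSpace L) :=
  OrthonormalBasis.mk (orthonormal_rotLink L g e)
    ((orthonormal_rotLink L g e).linearIndependent.span_eq_top_of_card_eq_finrank' (finrank_eq_card_basis e.toBasis).symm).ge

/-- Its vectors. [folklore] -/
theorem rotFrame_apply {ι : Type*} [Fintype ι] (g : Site 3 L → SU2) (e : OrthonormalBasis ι ℝ (LinkSpace L)) (i : ι) :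
    rotFrame L g e i = rotLink g (e i) := by
  rw [rotFrame, OrthonormalBasis.coe_mk]

/-- ★ **Gauge transport of diagonalising frames**: if `(e, a)` diagonalises `‖D_U·‖²` then `(R_g e, a)` diagonalises `‖D_{U^g}·‖²` with the SAME
values. [cite: Luscher1983, §3] -/
theorem Frame.IsDiag.rotate {ι : Type*} [Fintype ι] [DecidableEq ι] {U : GaugeConfig 3 L SU2} {e : OrthonormalBasis ι ℝ (LinkSpace L)}
    {a : ι → ℝ} (h : Frame.IsDiag (covCurl U) e a) (g : Site 3 L → SU2) :
    Frame.IsDiag (covCurl (gaugeTransform g U)) (rotFrame L g e) a := fun i j => by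
  rw [rotFrame_apply, rotFrame_apply, covCurl_gaugeTransform_eq, covCurl_gaugeTransform_eq, inner_rotPlaq, h i j]

/-- Hence the spectral sums of `‖D_U·‖²` are gauge invariant: frames at `U` and at `U^g` have the same `Σᵢ f(aᵢ)`. [cite: Luscher1983, §3] -/
theorem Frame.IsDiag.sum_eq_sum_gaugeTransform {ι ι' : Type*} [Fintype ι] [DecidableEq ι] [Fintype ι'] [DecidableEq ι']
    {U : GaugeConfig 3 L SU2} {e : OrthonormalBasis ι ℝ (LinkSpace L)} {a : ι → ℝ} (h : Frame.IsDiag (covCurl U) e a) (g : Site 3 L → SU2)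
    {e' : OrthonormalBasis ι' ℝ (LinkSpace L)} {a' : ι' → ℝ} (h' : Frame.IsDiag (covCurl (gaugeTransform g U)) e' a') (f : ℝ → ℝ) :
    ∑ i, f (a i) = ∑ j, f (a' j) :=
  (h.rotate L g).sum_eq_sum h' f

/-! ## §3 The zero-point sum on the gauge orbit of `V_θ` -/

/-- ★★★ **C3a ON THE GAUGE ORBIT**: for every gauge transformation `g` and EVERY orthonormal frame `(e, a)` of `LinkSpace L` diagonalising
`‖D_{g·V_θ}·‖²`, `Σᵢ modeZPE(κ aᵢ) = 2·toronZPE L κ 0 0 + 4·toronZPE L κ 0 (2θ)`. [cite: Luscher1983, §3] -/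
theorem sum_modeZPE_of_isDiag_covCurl_gaugeTransform_abelianCfg (g : Site 3 L → SU2) (θ : Fin 3 → ℝ) {ι : Type*} [Fintype ι] [DecidableEq ι]
    {e : OrthonormalBasis ι ℝ (LinkSpace L)} {a : ι → ℝ} (h : Frame.IsDiag (covCurl (gaugeTransform g (abelianCfg L θ))) e a) (κ : ℝ) :
    ∑ i, modeZPE (κ * a i) = 2 * toronZPE L κ 0 0 + 4 * toronZPE L κ 0 (fun k => 2 * θ k) := by
  classical
  rw [← (isDiag_linkFrame L θ).sum_eq_sum_gaugeTransform L g h (fun y => modeZPE (κ * y)), sum_modeZPE_linkValue]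

/-- The same for Mathlib's eigenframe of the covariant Hessian at `g·V_θ`. [cite: Luscher1983, §3] -/
theorem sum_modeZPE_eigenvalues_covHessian_gaugeTransform_abelianCfg (g : Site 3 L → SU2) (θ : Fin 3 → ℝ) {n : ℕ}
    (hn : finrank ℝ (LinkSpace L) = n) (κ : ℝ) :
    ∑ i, modeZPE (κ * (LinearMap.isPositive_adjoint_comp_self (covCurl (gaugeTransform g (abelianCfg L θ)))).isSymmetric.eigenvalues hn i) =
      2 * toronZPE L κ 0 0 + 4 * toronZPE L κ 0 (fun k => 2 * θ k) :=
  sum_modeZPE_of_isDiag_covCurl_gaugeTransform_abelianCfg L g θ (Frame.isDiag_eigenvectorBasis _ hn) κ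

/-! ## §4 Symmetries fixing `V_θ`: global `T₃`-rotations and lattice translations (frame transport for the valley's perturbation theory) -/

omit [NeZero L] in
/-- A global rotation about the `T₃` axis (constant diagonal gauge transformation) FIXES the constant abelian background. [cite: Luscher1983, §2] -/
theorem gaugeTransform_const_diagSU2_abelianCfg (α : ℝ) (θ : Fin 3 → ℝ) :
    gaugeTransform (fun _ : Site 3 L => diagSU2 α) (abelianCfg L θ) = abelianCfg L θ := by
  funext e
  simp only [gaugeTransform, abelianCfg]
  rw [← diagSU2_neg, ← diagSU2_add, ← diagSU2_add]
  congr 1; ring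

/-- Hence global `T₃`-rotations transport diagonalising frames of `‖D_{V_θ}·‖²` to diagonalising frames of the SAME form. [cite: Luscher1983, §3] -/
theorem Frame.IsDiag.rotateT3 {ι : Type*} [Fintype ι] [DecidableEq ι] {θ : Fin 3 → ℝ} {e : OrthonormalBasis ι ℝ (LinkSpace L)} {a : ι → ℝ}
    (h : Frame.IsDiag (covCurl (abelianCfg L θ)) e a) (α : ℝ) :
    Frame.IsDiag (covCurl (abelianCfg L θ)) (rotFrame L (fun _ : Site 3 L => diagSU2 α) e) a := by
  have h1 := h.rotate L (fun _ : Site 3 L => diagSU2 α)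
  rwa [gaugeTransform_const_diagSU2_abelianCfg] at h1

/-- Lattice translation of a gauge configuration: `(τ_y U)(x, i) = U(x + y, i)`. [folklore] -/
def shiftCfg (y : Site 3 L) (U : GaugeConfig 3 L SU2) : GaugeConfig 3 L SU2 := fun e => U (e.1 + y, e.2)

/-- Lattice translation of link 1-forms. [folklore] -/
def shiftLink (y : Site 3 L) (w : LinkSpace L) : LinkSpace L := WithLp.toLp 2 fun ea : Edge 3 L × Fin 3 => w ((ea.1.1 + y, ea.1.2), ea.2)

/-- Lattice translation of plaquette 2-forms. [folklore] -/
def shiftPlaq (y : Site 3 L) (F : PlaqSpace L) : PlaqSpace L := WithLp.toLp 2 fun pa : Plaquette 3 L × Fin 3 => F ((pa.1.1 + y, pa.1.2), pa.2)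

omit [NeZero L] in
/-- Components. [folklore] -/
theorem shiftLink_apply (y : Site 3 L) (w : LinkSpace L) (e : Edge 3 L) (a : Fin 3) : shiftLink L y w (e, a) = w ((e.1 + y, e.2), a) := rfl

omit [NeZero L] in
/-- Components. [folklore] -/
theorem shiftPlaq_apply (y : Site 3 L) (F : PlaqSpace L) (p : Plaquette 3 L) (a : Fin 3) :
    shiftPlaq L y F (p, a) = F ((p.1 + y, p.2), a) := rfl

omit [NeZero L] in
/-- `(x + y) + eᵢ = (x + eᵢ) + y`. [folklore] -/
theorem shift_add_comm (x y : Site 3 L) (i : Fin 3) : (x + y).shift i = x.shift i + y := by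
  simp only [Site.shift]; abel

omit [NeZero L] in
/-- The constant abelian background is translation invariant. [folklore] -/
theorem shiftCfg_abelianCfg (y : Site 3 L) (θ : Fin 3 → ℝ) : shiftCfg L y (abelianCfg L θ) = abelianCfg L θ := rfl

omit [NeZero L] in
/-- Partial holonomies and holonomy translate. [folklore] -/
theorem ptrans_shiftCfg (y : Site 3 L) (U : GaugeConfig 3 L SU2) (p : Plaquette 3 L) :
    ptrans1 (shiftCfg L y U) p = ptrans1 U (p.1 + y, p.2) ∧ ptrans2 (shiftCfg L y U) p = ptrans2 U (p.1 + y, p.2) ∧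
      hol (shiftCfg L y U) p = hol U (p.1 + y, p.2) := by
  refine ⟨rfl, ?_, ?_⟩
  · simp only [ptrans2, shiftCfg, shift_add_comm]
  · simp only [hol, plaquetteHolonomy, shiftCfg, shift_add_comm]

omit [NeZero L] in
/-- ★ **Translation covariance of the covariant curl**: `D_{τ_y U}(τ_y w) = τ_y (D_U w)`. [cite: Luscher1983, §3] -/
theorem covCurl_shiftCfg (y : Site 3 L) (U : GaugeConfig 3 L SU2) (w : LinkSpace L) :
    covCurl (shiftCfg L y U) (shiftLink L y w) = shiftPlaq L y (covCurl U w) := by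
  ext ⟨⟨x, kl⟩, a⟩
  obtain ⟨h1, h2, h3⟩ := ptrans_shiftCfg L y U (x, kl)
  rw [shiftPlaq_apply, covCurl_apply, covCurl_apply, h1, h2, h3]
  simp only [shiftLink_apply, shift_add_comm]

/-- Translations preserve inner products of link forms. [folklore] -/
theorem inner_shiftLink (y : Site 3 L) (v w : LinkSpace L) : ⟪shiftLink L y v, shiftLink L y w⟫_ℝ = ⟪v, w⟫_ℝ := by
  rw [PiLp.inner_apply, PiLp.inner_apply]
  exact Fintype.sum_equiv ((Equiv.prodCongrLeft fun _ => Equiv.prodCongrLeft fun _ => Equiv.addRight y) :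
    Edge 3 L × Fin 3 ≃ Edge 3 L × Fin 3) _ _ fun _ => rfl

/-- Translations preserve inner products of plaquette forms. [folklore] -/
theorem inner_shiftPlaq (y : Site 3 L) (F G : PlaqSpace L) : ⟪shiftPlaq L y F, shiftPlaq L y G⟫_ℝ = ⟪F, G⟫_ℝ := by
  rw [PiLp.inner_apply, PiLp.inner_apply]
  exact Fintype.sum_equiv ((Equiv.prodCongrLeft fun _ => Equiv.prodCongrLeft fun _ => Equiv.addRight y) :
    Plaquette 3 L × Fin 3 ≃ Plaquette 3 L × Fin 3) _ _ fun _ => rfl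

/-- A translated orthonormal frame is orthonormal. [folklore] -/
theorem orthonormal_shiftLink {ι : Type*} [Fintype ι] (y : Site 3 L) (e : OrthonormalBasis ι ℝ (LinkSpace L)) :
    Orthonormal ℝ (fun i => shiftLink L y (e i)) := by
  classical
  rw [orthonormal_iff_ite]
  intro i j
  rw [inner_shiftLink, orthonormal_iff_ite.mp e.orthonormal i j]

/-- The translated frame as an orthonormal basis. [folklore] -/
def shiftFrame {ι : Type*} [Fintype ι] (y : Site 3 L) (e : OrthonormalBasis ι ℝ (LinkSpace L)) : OrthonormalBasis ι ℝ (LinkSpace L) :=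
  OrthonormalBasis.mk (orthonormal_shiftLink L y e)
    ((orthonormal_shiftLink L y e).linearIndependent.span_eq_top_of_card_eq_finrank' (finrank_eq_card_basis e.toBasis).symm).ge

/-- Its vectors. [folklore] -/
theorem shiftFrame_apply {ι : Type*} [Fintype ι] (y : Site 3 L) (e : OrthonormalBasis ι ℝ (LinkSpace L)) (i : ι) :
    shiftFrame L y e i = shiftLink L y (e i) := by
  rw [shiftFrame, OrthonormalBasis.coe_mk]

/-- ★ **Translation transport of diagonalising frames**: `(e, a)` diagonalises `‖D_U·‖²` ⇒ `(τ_y e, a)` diagonalises `‖D_{τ_y U}·‖²`. [cite: Luscher1983, §3] -/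
theorem Frame.IsDiag.translate {ι : Type*} [Fintype ι] [DecidableEq ι] {U : GaugeConfig 3 L SU2} {e : OrthonormalBasis ι ℝ (LinkSpace L)}
    {a : ι → ℝ} (h : Frame.IsDiag (covCurl U) e a) (y : Site 3 L) :
    Frame.IsDiag (covCurl (shiftCfg L y U)) (shiftFrame L y e) a := fun i j => by
  rw [shiftFrame_apply, shiftFrame_apply, covCurl_shiftCfg, covCurl_shiftCfg, inner_shiftPlaq, h i j]

/-- In particular at the translation-invariant `V_θ`: translations act on the diagonalising frames of `‖D_{V_θ}·‖²` (same form, same values).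
[cite: Luscher1983, §3] -/
theorem Frame.IsDiag.translate_abelianCfg {ι : Type*} [Fintype ι] [DecidableEq ι] {θ : Fin 3 → ℝ} {e : OrthonormalBasis ι ℝ (LinkSpace L)}
    {a : ι → ℝ} (h : Frame.IsDiag (covCurl (abelianCfg L θ)) e a) (y : Site 3 L) :
    Frame.IsDiag (covCurl (abelianCfg L θ)) (shiftFrame L y e) a :=
  h.translate L y

end Summit.QuantumFields.YangMills.Theorems.FemtoTransferGap.TwoLattice.Toron

end
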